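import Summits.BirchSwinnertonDyer.BirchSwinnertonDyer.Theorems.ByReductionTypeAtTwoOrdEisensteinHalfEquivalence
import Summits.BirchSwinnertonDyer.BirchSwinnertonDyer.Theorems.ByReductionTypeAtTwoOrdEisensteinHalfShaIsogeny
import Summits.BirchSwinnertonDyer.BirchSwinnertonDyer.Theorems.ByReductionTypeAtTwoOrdIsogenyTransport
import Summits.BirchSwinnertonDyer.BirchSwinnertonDyer.Theorems.TwoAdicConverseLambdaHalfDefs
import Summits.BirchSwinnertonDyer.BirchSwinnertonDyer.Theorems.ByReductionTypeAtTwoAnalyticMuLETwo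
import Summits.BirchSwinnertonDyer.Rank1Residual.X5.TwoAdicTargetsPub
import Summits.BirchSwinnertonDyer.Rank1Residual.X12.CMIsogenyInvariance
import Literature.Uncategorized.OrdPublishedInputsAtTwo
import Summits.BirchSwinnertonDyer.BirchSwinnertonDyer.Theorems.ByReductionTypeAtTwoOrdMissingLowerBoundDefs
import Literature.NumberTheory.EllipticCurves.ModTwoReducibleIffTwoTorsionRoot
import Literature.NumberTheory.EllipticCurves.BSDSelmerSmithNoRationalTwoTorsionProofs
import Literature.NumberTheory.EllipticCurves.TwoAdicImageQuadraticTwistProofs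
import Literature.NumberTheory.EllipticCurves.IsogenyCompProofs
import Literature.NumberTheory.EllipticCurves.IsogenyIdProofs
import HarnessLib

/-!
# Route `ByReductionTypeAtTwo` (K4), crux `OrdMissingLowerBoundAtTwo` (stmt-BirchSwinnertonDyer-19577), line
# `kato-free-lower-sandwich-two` — RUNG (0): the KATO-FREE SANDWICH, proved spine (`--supports`)

Cell `bsd-2adic`, lead `cruxlead-stmt-BirchSwinnertonDyer-19577` (g0).  THEOREMS ONLY — no definition, no named fact, no
`sorry`; every published input is a displayed hypothesis.  HONEST FRAMING: the crux 19577 (`ord₂ #Ш_an ≤ ord₂ #Ш[2^∞]` at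
every non-CM analytic-rank-`0` good-ordinary-at-`2` curve) is NOT closed here; BSD is not proved by any of this.

WHAT IS PROVED (the spine §0–§1b of the registered skeleton `Cruxes/OrdMissingLowerBoundAtTwo/Lines/kato_free_lower_sandwich_two.lean`,
with the line's local predicate `AnalyticMuNonpos` (slack form) REPLACED by the tree's certificate currency
`X1.MuPart.AnalyticMuLE W 2 0` (coefficient form; it implies the slack form, `mu_le_slack_of_analyticMuLE`, and on the
good-ordinary locus nothing is lost), so that no new definition is introduced):

* §0 `mu_le_slack_of_analyticMuLE` — coefficient form ⇒ slack form: if some coefficient of `ϖ·L₂(f,α)` has norm `> 2⁻¹`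
  then every INTEGRAL `L₀` with `ι L₀ = 2ʲ·ϖ·L₂(f,α)` has `μ(L₀) ≤ j`.
* §1 `eisenstein_of_kato_of_lambdaHalf_of_analyticMuLE` — the SANDWICH: Kato 17.4 (1)(2) AT `2` (PRINT, `h17`, with slack) +
  the `λ`-half `LambdaHalfAtTwo W` (S3 crux 19556 AT `W`) + `AnalyticMuLE W 2 0` ⇒ `MainConjectureEisensteinDivisibilityAtTwo W`.
  NO Kato–Néron half (item 19573), NO period integrality, NO `μ(X) = 0`: the `μ`-inequality `μ(L₀) ≤ μ(X) + j` is FREE from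
  `μ(L₀) ≤ j` because `μ(X) ≥ 0`.  Then `missingLowerBoundAt_two_of_lambdaHalf_of_analyticMuLE` (item 19577 AT `W`, through the
  X5 door `missingLowerBoundAt_two_of_eisenstein_of_kato`) and the `∀`-closed form
  `ordMissingLowerBoundAtTwo_of_lambdaHalf_of_analyticMuLEWitness`: PUB ∧ Cassels ∧ `OrdLambdaHalfAtTwo` ∧ (a `μ_an ≤ 0` member per
  class) ⇒ the LEAF `Theorems.OrdHalvesAtTwo.OrdMissingLowerBoundAtTwo` — compare the tree's
  `ordMissingLowerBoundAtTwo_of_katoHalfIso_of_lambdaHalf`, whose Kato-crux hypothesis `hβ` (item 19573) is DROPPED here.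
* §1b `analyticMuLE_two_zero_of_noRationalTwoTorsion_of_abbesUllmo` (no rational point of order `2` ⇒ `E[2]` irreducible): on the good-ordinary locus WITHOUT rational `2`-torsion the
  `μ`-witness is the curve itself (p641918 `AnalyticMuTwo.analyticMuLE_two_zero_of_goodOrd_of_irr_of_abbesUllmo`, mod Abbes–Ullmo).
* §2 `ordMissingLowerBoundAtTwo_of_lambdaHalf_of_selector` — the line's COMPOSITION over an arbitrary SELECTOR predicate
  `P W W″` (the skeleton instantiates `P` := «`W″` is the plateau member» / «`W″` has 2-adically maximal real period in its class»):
  PUB ∧ Cassels ∧ AU ∧ 19556 ∧ (every reducible good-ordinary curve has a `P`-member) ∧ (`μ_an ≤ 0` at `P`-members of reducible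
  non-CM rank-`0` good-ordinary classes) ⇒ LEAF.  The by-name instantiation with the route decls of `Theses.ByReductionTypeAtTwo`
  is left to the closing skeleton (this module imports NO route file and stays outside every Theses cone).

References: K. Kato, Astérisque 295 (2004), Thm. 17.4 (1)(2); R. Greenberg, LNM 1716 (1999), Thm. 4.1, §5; A. Abbes, E. Ullmo,
Compositio Math. 103 (1996), Thm. A; J. Milne, *Arithmetic Duality Theorems*, Thm. I.7.3 (Cassels).
-/

set_option autoImplicit false
-- the sub-problem namespace repeats the summit name by design (D-0017 nested layout)
set_option linter.dupNamespace false

noncomputable section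

open scoped Classical MatrixGroups ModularForm

open CongruenceSubgroup WeierstrassCurve Literature.NumberTheory.EllipticCurves
  Literature.NumberTheory.EllipticCurves.ModularForms Literature.NumberTheory.EllipticCurves.Rank1Residual
  Literature.NumberTheory.EllipticCurves.Rank1Residual.Typed
  Literature.NumberTheory.EllipticCurves.Greenberg1999
  Summit.BirchSwinnertonDyer.Rank1Residual.X1.MuLambda
  Summit.BirchSwinnertonDyer.Rank1Residual.X1.MuPart
  Summit.BirchSwinnertonDyer.Rank1Residual.X5
  Summit.BirchSwinnertonDyer.Rank1Residual.X5.O1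
  Summit.BirchSwinnertonDyer.Rank1Residual
  Summit.BirchSwinnertonDyer.BirchSwinnertonDyer.Theorems.TwoAdicTwistConverse
  Summit.BirchSwinnertonDyer.BirchSwinnertonDyer.Theorems.EisensteinLowerBounds
  Summit.BirchSwinnertonDyer.BirchSwinnertonDyer.Theorems.EisensteinShaCurrency
  Summit.BirchSwinnertonDyer.BirchSwinnertonDyer.Theorems.IsogenyMuShift

namespace Summit.BirchSwinnertonDyer.BirchSwinnertonDyer.Theorems.KatoFreeSandwich

/-! ## §0 Coefficient form ⇒ slack form -/

section Curve

variable (W : WeierstrassCurve ℚ) [W.IsElliptic] [W.IsGloballyMinimal]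

/-- **Coefficient form ⇒ slack form.**  If some coefficient of `ϖ·L₂(f,α,T)` has `2`-adic norm `> 2⁻¹`
(`AnalyticMuLE W 2 0`), then every integral `L₀ ∈ Λ` with `ι L₀ = 2ʲ·ϖ·L₂(f,α,T)` has `μ(L₀) ≤ j`
(`‖2ʲa‖₂ = 2⁻ʲ‖a‖₂ > 2^{-(j+1)}` at that coefficient, `mu_le_of_lt_norm_coeff`). [folklore] -/
theorem mu_le_slack_of_analyticMuLE (hA : AnalyticMuLE W 2 0) [NeZero (W.conductorNorm ℤ)]
    (f : CuspForm (Gamma0 (W.conductorNorm ℤ)) 2) (hf : IsNewformOf W f) (ϖ : ℚ)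
    (hϖ : (ϖ : ℝ) * W.realPeriodRat = plusPeriod f) (j : ℕ) (L₀ : IwasawaAlgebra 2)
    (hL₀ : iwasawaToPowerSeries 2 L₀ =
      PowerSeries.C (((2 : ℚ) ^ j * ϖ : ℚ) : ℚ_[2]) * padicLFunction f (unitRoot W 2 : ℚ_[2])) :
    mu L₀ ≤ j := by
  obtain ⟨n, hn⟩ := hA f hf ϖ hϖ
  have h2 : ‖(2 : ℚ_[2])‖ = (2 : ℝ)⁻¹ := by
    have h := Padic.norm_p (p := 2)
    exact_mod_cast h
  have hcoeff : PowerSeries.coeff n (iwasawaToPowerSeries 2 L₀) =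
      (2 : ℚ_[2]) ^ j * PowerSeries.coeff n
        (PowerSeries.C (ϖ : ℚ_[2]) * padicLFunction f (unitRoot W 2 : ℚ_[2])) := by
    rw [hL₀, PowerSeries.coeff_C_mul, PowerSeries.coeff_C_mul]
    push_cast
    ring
  have key : (2 : ℝ) ^ (-((j : ℤ) + 1)) = ((2 : ℝ)⁻¹) ^ j * (2 : ℝ) ^ (-(1 : ℤ)) := by
    rw [neg_add, zpow_add₀ two_ne_zero, zpow_neg (2 : ℝ) (j : ℤ), zpow_natCast, inv_pow]
  refine mu_le_of_lt_norm_coeff (p := 2) (n := n) ?_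
  simp only [Nat.cast_ofNat, Nat.cast_zero, zero_add] at hn ⊢
  rw [hcoeff, norm_mul, norm_pow, h2, key]
  exact mul_lt_mul_of_pos_left hn (pow_pos (by norm_num) j)

/-! ## §1 Eisenstein divisibility WITHOUT the Kato half (the sandwich) -/

/-- **Eisenstein divisibility at `W` from Kato 17.4 (1)(2) AT `2`, the `λ`-half and `μ_an ≤ 0`.**  NO Kato–Néron half
(item 19573), NO period integrality `0 ≤ ord₂ ϖ`, NO `μ(X) = 0`: with `X ∣ L` (Kato, slack `j`), `λ(X) ≥ λ(L)` (the
`λ`-half) and `μ(L₀) ≤ j ≤ μ(X) + j`, the datum-wise criterion `eisensteinAtDatum_iff_lam_le_and_mu_le_slack` fires.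
[cite: Kato2004Asterisque, Thm. 17.4 (1)(2) (p. 273)] -/
theorem eisenstein_of_kato_of_lambdaHalf_of_analyticMuLE
    (h17 : ∀ [NeZero (W.conductorNorm ℤ)] (f : CuspForm (Gamma0 (W.conductorNorm ℤ)) 2),
      kato_divisibility_allPrimes W 2 (f := f))
    (hL : LambdaHalfAtTwo W) (hA : AnalyticMuLE W 2 0) :
    MainConjectureEisensteinDivisibilityAtTwo W := by
  intro κ γ hκ hγ hγ' hord _ f hf ϖ hϖ D fX hchar
  have hϖ0 : ϖ ≠ 0 := by
    rintro rfl
    have hper : 0 < plusPeriod f := IsNewform0.plusPeriod_pos_holds hf.1 hf.coeffField_eq_bot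
    rw [← hϖ, Rat.cast_zero, zero_mul] at hper
    exact lt_irrefl _ hper
  obtain ⟨j, L₀, hL₀0, hL₀⟩ := exists_integral_slack W hord hf hϖ0
  have hμL₀ : mu L₀ ≤ j := mu_le_slack_of_analyticMuLE W hA f hf ϖ hϖ j L₀ hL₀
  obtain ⟨c, L₁, hL₁0, hL₁, hlamL₁⟩ := hL κ γ hκ hγ hγ' hord f hf D
  -- `λ(L₀) = λ(L₁)`: both are nonzero integral rational multiples of the same series (clear denominators,
  -- `C(A)·L₀ = C(B)·L₁` in `Λ` with `A, B ∈ ℤ ∖ {0}`, and `λ(C A) = λ(C B) = 0`)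
  have hlam : lam L₀ = lam L₁ := by
    set a : ℚ := (2 : ℚ) ^ j * ϖ with ha_def
    have hιC : ∀ x : ℤ_[2], iwasawaToPowerSeries 2 (PowerSeries.C x) = PowerSeries.C (x : ℚ_[2]) :=
      fun x => by rw [iwasawaToPowerSeries, PowerSeries.map_C]; rfl
    have hι1 : iwasawaToPowerSeries 2 L₁ ≠ 0 := fun h =>
      hL₁0 (iwasawaToPowerSeries_injective 2 (by rw [h, map_zero]))
    have ha0 : a ≠ 0 := mul_ne_zero (pow_ne_zero _ two_ne_zero) hϖ0
    have hc0 : c ≠ 0 := by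
      rintro rfl
      exact hι1 (by rw [hL₁]; simp)
    set A : ℤ := c.num * a.den with hA
    set B : ℤ := a.num * c.den with hB
    have hA0 : A ≠ 0 := mul_ne_zero (Rat.num_ne_zero.mpr hc0) (Int.natCast_ne_zero.mpr a.den_nz)
    have hB0 : B ≠ 0 := mul_ne_zero (Rat.num_ne_zero.mpr ha0) (Int.natCast_ne_zero.mpr c.den_nz)
    have hAZ : ((A : ℤ_[2])) ≠ 0 := by exact_mod_cast hA0
    have hBZ : ((B : ℤ_[2])) ≠ 0 := by exact_mod_cast hB0
    have hab : (A : ℚ) * a = (B : ℚ) * c := by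
      have h1 : (a.den : ℚ) * a = a.num := by rw [mul_comm]; exact Rat.mul_den_eq_num a
      have h2 : (c.den : ℚ) * c = c.num := by rw [mul_comm]; exact Rat.mul_den_eq_num c
      rw [hA, hB]
      push_cast
      rw [mul_assoc, h1, mul_assoc, h2, mul_comm]
    have habQ : ((A : ℤ_[2]) : ℚ_[2]) * (a : ℚ_[2]) = ((B : ℤ_[2]) : ℚ_[2]) * (c : ℚ_[2]) := by
      have := congrArg (fun q : ℚ => (q : ℚ_[2])) hab
      push_cast at this
      simpa using this
    have haQ : ((a : ℚ) : ℚ_[2]) = (((2 : ℚ) ^ j * ϖ : ℚ) : ℚ_[2]) := by rw [ha_def]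
    have key : PowerSeries.C (A : ℤ_[2]) * L₀ = PowerSeries.C (B : ℤ_[2]) * L₁ := by
      apply iwasawaToPowerSeries_injective 2
      rw [map_mul, map_mul, hιC, hιC, hL₀, hL₁, ← mul_assoc, ← mul_assoc, ← map_mul, ← map_mul, ← haQ, habQ]
    have e := congrArg lam key
    rwa [lam_mul (by rwa [Ne, ← map_zero (PowerSeries.C (R := ℤ_[2])), PowerSeries.C_injective.eq_iff])
        hL₀0, lam_mul (by rwa [Ne, ← map_zero (PowerSeries.C (R := ℤ_[2])), PowerSeries.C_injective.eq_iff])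
        hL₁0, LambdaConstPinch.lam_C hAZ, LambdaConstPinch.lam_C hBZ, zero_add, zero_add] at e
  exact (eisensteinAtDatum_iff_lam_le_and_mu_le_slack W (h17 f) hκ hγ hγ' hord hf D hchar hL₀0 hL₀).mpr
    ⟨hlam ▸ hlamL₁, hμL₀.trans (Nat.le_add_left j D.mu)⟩

/-- **`MissingLowerBoundAt W 2` (item 19577 AT `W`) from PRINT + `λ`-half + `μ_an ≤ 0`** (analytic rank `0`, good
ordinary at `2`), through the X5 door `missingLowerBoundAt_two_of_eisenstein_of_kato`.
[cite: Kato2004Asterisque, Thm. 17.4 (1)(2) (p. 273)] [cite: GreenbergLNM1716, Thm. 4.1 (p. 102)] -/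
theorem missingLowerBoundAt_two_of_lambdaHalf_of_analyticMuLE
    (hmod : nonempty_modularParametrizationData) (hGZK : rank_eq_analyticRank_of_analyticRank_le_one)
    (h17 : ∀ [NeZero (W.conductorNorm ℤ)] (f : CuspForm (Gamma0 (W.conductorNorm ℤ)) 2),
      kato_divisibility_allPrimes W 2 (f := f))
    (hEC : TwoAdicEulerCharRankZero W 0) (hgo : GoodOrd W 2) (hr : W.analyticRank = 0)
    (hL : LambdaHalfAtTwo W) (hA : AnalyticMuLE W 2 0) : MissingLowerBoundAt W 2 :=
  missingLowerBoundAt_two_of_eisenstein_of_kato W hEC hmod hGZK h17 hr hgo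
    (eisenstein_of_kato_of_lambdaHalf_of_analyticMuLE W h17 hL hA)

/-! ## §1b The `E[2]`-irreducible branch: the `μ`-witness is the curve itself (mod Abbes–Ullmo) -/

/-- **On the good-ordinary locus WITHOUT rational `2`-torsion, `μ_an ≤ 0` at the curve itself**, modulo the print
binder `hAU` (Abbes–Ullmo 1996 Thm. A), by p641918
`AnalyticMuTwo.analyticMuLE_two_zero_of_goodOrd_of_irr_of_abbesUllmo`. [cite: AbbesUllmo1996, Thm. A] -/
theorem analyticMuLE_two_zero_of_noRationalTwoTorsion_of_abbesUllmo
    (hAU : abbesUllmo_not_dvd_maninConstant_of_not_dvd_level) (hgo : GoodOrd W 2)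
    (h2 : ∀ x : ℚ, ¬ HasRationalTwoTorsionX W x) : AnalyticMuLE W 2 0 :=
  -- no rational point of order `2` ⟹ `E[2]` irreducible (a Galois-stable line of `E[2]` is a rational point; the
  -- tree's `AlignedTransportAtTwoClosure.irr_two_of_forall_not_hasRationalTwoTorsionX`, re-derived inline to keep this
  -- module outside every route cone)
  have hirr : W.HasIrreducibleModPGaloisRep 2 := by
    by_contra h
    obtain ⟨x₀, hx₀⟩ := W.exists_isRoot_twoTorsionPolynomial_of_not_hasIrreducibleModPGaloisRep_two h
    rw [isRoot_twoTorsionPolynomial_iff] at hx₀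
    exact h2 x₀ ((hasRationalTwoTorsionX_iff_twoDivision W x₀).mpr hx₀)
  AnalyticMuTwo.analyticMuLE_two_zero_of_goodOrd_of_irr_of_abbesUllmo W hAU hgo hirr

end Curve

/-! ## §1c The `∀`-closed Kato-free reduction -/

section Crux

/-- **K4's descent crux (its LEAF `Theorems.OrdHalvesAtTwo.OrdMissingLowerBoundAtTwo`) from S3's `λ`-crux and a
`μ_an ≤ 0` member per class — the Kato crux DROPPED.**  Granted `OrdPublishedInputsAtTwo` (modularity, GZK, Kato
17.4 (1)(2) AT `2`, Greenberg 4.1@2) and Cassels: IF the `λ`-half holds at every non-CM good-ordinary-at-`2` curve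
(`hΛ`, item 19556) AND every non-CM rank-`0` good-ordinary-at-`2` curve is isogenous to a globally minimal curve with
`AnalyticMuLE · 2 0` (`hμ`), THEN item 19577's leaf.  Compare `ordMissingLowerBoundAtTwo_of_katoHalfIso_of_lambdaHalf`
(same file family), which assumes in addition the Kato crux 19573 (`hβ`).
[cite: Kato2004Asterisque, Thm. 17.4 (1)(2) (p. 273)] [cite: GreenbergLNM1716, Thm. 4.1 (p. 102)] [cite: MilneADT2006, Thm. I.7.3] -/
theorem ordMissingLowerBoundAtTwo_of_lambdaHalf_of_analyticMuLEWitness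
    (hPub : Literature.Uncategorized.OrdPublishedInputsAtTwo) (hCassels : bsdRHS_eq_of_isIsogenous)
    (hΛ : TwoAdicTwistConverse.OrdLambdaHalfAtTwo)
    (hμ : ∀ (W : WeierstrassCurve ℚ) [W.IsElliptic] [W.IsGloballyMinimal], ¬ W.HasCM →
      W.analyticRank = 0 → GoodOrd W 2 →
      ∃ (W'' : WeierstrassCurve ℚ) (_ : W''.IsElliptic) (_ : W''.IsGloballyMinimal),
        IsIsogenous W W'' ∧ AnalyticMuLE W'' 2 0) :
    Summit.BirchSwinnertonDyer.BirchSwinnertonDyer.Theorems.OrdHalvesAtTwo.OrdMissingLowerBoundAtTwo := by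
  have hPub' := hPub
  obtain ⟨hmod, hGZK, h17, hGr⟩ := hPub'
  intro W _ _ hcm hr hgo
  obtain ⟨W'', _, _, hiso'', hμ''⟩ := hμ W hcm hr hgo
  have hcm'' : ¬ W''.HasCM := fun h => hcm ((X12.hasCM_iff_of_isIsogenous hiso'').mpr h)
  have hr'' : W''.analyticRank = 0 := by rw [← analyticRank_eq_of_isIsogenous' hiso'']; exact hr
  have hgo'' : GoodOrd W'' 2 := isOrdinaryAt_of_isIsogenous hiso'' hgo
  exact missingLowerBoundAt_two_of_isIsogenous W hCassels hGZK hmod hr hiso''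
    (missingLowerBoundAt_two_of_lambdaHalf_of_analyticMuLE W'' hmod hGZK (h17 W'')
      (twoAdicEulerCharRankZero_zero_of_greenberg W'' hGr) hgo'' hr'' (hΛ W'' hcm'' hgo'') hμ'')

/-! ## §2 The line's composition over a SELECTOR predicate -/

/-- **LEAF ⟸ PUB ∧ PUB-rider ∧ AU ∧ 19556 ∧ (a `P`-member in every reducible good-ordinary class) ∧ (`μ_an ≤ 0` at
`P`-members).**  `P W W″` is any selector of a member `W″` of the class of `W` (the line uses «plateau member» /
«member of 2-adically maximal real period»); on the locus without rational `2`-torsion the witness is `W` itself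
(§1b, mod AU), so `P`-members are only needed where a rational point of order `2` exists.
[cite: Kato2004Asterisque, Thm. 17.4 (1)(2) (p. 273)] [cite: AbbesUllmo1996, Thm. A] [cite: MilneADT2006, Thm. I.7.3] -/
theorem ordMissingLowerBoundAtTwo_of_lambdaHalf_of_selector
    (P : ∀ (W W'' : WeierstrassCurve ℚ), Prop)
    (hPub : Literature.Uncategorized.OrdPublishedInputsAtTwo) (hCassels : bsdRHS_eq_of_isIsogenous)
    (hAU : abbesUllmo_not_dvd_maninConstant_of_not_dvd_level)
    (hΛ : TwoAdicTwistConverse.OrdLambdaHalfAtTwo)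
    (hsel : ∀ (W : WeierstrassCurve ℚ) [W.IsElliptic] [W.IsGloballyMinimal],
      GoodOrd W 2 → (∃ x : ℚ, HasRationalTwoTorsionX W x) →
      ∃ (W'' : WeierstrassCurve ℚ) (_ : W''.IsElliptic) (_ : W''.IsGloballyMinimal), IsIsogenous W W'' ∧ P W W'')
    (hμP : ∀ (W W'' : WeierstrassCurve ℚ) [W.IsElliptic] [W.IsGloballyMinimal] [W''.IsElliptic] [W''.IsGloballyMinimal],
      ¬ W.HasCM → W.analyticRank = 0 → GoodOrd W 2 → IsIsogenous W W'' →
      (∃ x : ℚ, HasRationalTwoTorsionX W x) → P W W'' → AnalyticMuLE W'' 2 0) :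
    Summit.BirchSwinnertonDyer.BirchSwinnertonDyer.Theorems.OrdHalvesAtTwo.OrdMissingLowerBoundAtTwo := by
  refine ordMissingLowerBoundAtTwo_of_lambdaHalf_of_analyticMuLEWitness hPub hCassels hΛ ?_
  intro W _ _ hcm hr hgo
  by_cases h2 : ∃ x : ℚ, HasRationalTwoTorsionX W x
  · obtain ⟨W'', hE, hM, hiso, hP⟩ := hsel W hgo h2
    exact ⟨W'', hE, hM, hiso, @hμP W W'' _ _ hE hM hcm hr hgo hiso h2 hP⟩
  · push Not at h2
    exact ⟨W, ‹_›, ‹_›, isIsogenous_self W, analyticMuLE_two_zero_of_noRationalTwoTorsion_of_abbesUllmo W hAU hgo h2⟩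

end Crux

end Summit.BirchSwinnertonDyer.BirchSwinnertonDyer.Theorems.KatoFreeSandwich

end
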